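import Summits.ValiantsHypothesis.ValiantsHypothesis.Theorems.LacunarySymmetroidMatrixDescartesFiniteSectorSectorCeilingTwentyoneFourA
import Summits.ValiantsHypothesis.ValiantsHypothesis.Theorems.LacunarySymmetroidMatrixDescartesFiniteSectorSectorCeilingTwentyoneFourB
import Summits.ValiantsHypothesis.ValiantsHypothesis.Theorems.LacunarySymmetroidMatrixDescartesFiniteSectorSectorCeilingTwentyoneFourC
import Summits.ValiantsHypothesis.ValiantsHypothesis.Theorems.LacunarySymmetroidMatrixDescartesFiniteSectorSectorCeilingTwentyoneFourD
import Summits.ValiantsHypothesis.ValiantsHypothesis.Theorems.LacunarySymmetroidMatrixDescartesFiniteSectorSumMasksHigherNine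

/-!
# `MatrixDescartes` — line «finite»: the SECTOR CEILING `η(21,4) ≤ σ(21,4) = 1610` (kernel) — `HypRootLawAt 21 4 1610`, Conjecture Σ's value
# `2·n(21,3)` at the cell `(21,4)`

HONEST FRAMING.  Object-search cell `pub-symmetroid`, seat val-sym-door-p5 g10 (generators of val-sym-door-p5 g8/g9 VERBATIM, m-tables extended to m ≤ 19; fold binders typed `(x acc : ℕ)` — same elaborated terms, fast elaboration).  HELPER of the crux item `stmt-ValiantsHypothesis-18050` with NO closure claim.  The SIEVE of
line «finite» (`FiniteSector.sieve`, `natDegree_mem_sumset`) makes the `21`-fold sums of exponents of an in-sector pencil a step-≤-2 chain from `0` up to the degree;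
the finite core — no `3` positive values carry such a chain beyond `1610` — has 10034 live prefixes and is decided in the kernel in SLICES by the two smallest positive
values `(a,b)` (`a ≤ 2` and `b ≤ 21a + 2` are forced by the chain at `r = 1` and `r = 21a + 1`): slices (1,2), (1,3), (1,4), (1,5), (1,6), (1,7), (1,8), (1,9), (1,10), (1,11), (1,12), (1,13), (1,14), (1,15), (1,16), (1,17), (1,18), (1,19), (1,20), (1,21), (1,22), (1,23), (2,3), (2,4), (2,5), (2,6), (2,7), (2,8), (2,9), (2,10), (2,11), (2,12), (2,13), (2,14), (2,15), (2,16), (2,17), (2,18), (2,19), (2,20), (2,21), (2,22), (2,23), (2,24), (2,25), (2,26), (2,27), (2,28), (2,29), (2,30), (2,31), (2,32), (2,33), (2,34), (2,35), (2,36), (2,37), (2,38), (2,39), (2,40), (2,41), (2,42), (2,43), (2,44) in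
`…FiniteSectorSectorCeilingTwentyoneFourA`, `…FiniteSectorSectorCeilingTwentyoneFourB`, `…FiniteSectorSectorCeilingTwentyoneFourC`, `…FiniteSectorSectorCeilingTwentyoneFourD` (this file holds the transfer only); `21`-fold sums as iterated shift-form
bitmasks (`…FiniteSectorSumMasksHigher`).  Result: `hypRootLawAt_twentyone_four_1610 : HypRootLawAt 21 4 1610`.  Located first (exact DFS, this seat, HOME/val-sym-door-p5/g9/work/mask/slice_count_m.py):
the chain survives to `1609` only on the doubled extremal basis `2·{0,1,17,91}` — `σ(21,4) = 1610 = 2·n(21,3)`, Conjecture Σ of `Lines/finite.md` at the NEW cell `(21,4)`; the lower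
side needs a realised doubled basis and is NOT claimed here.  Nothing here bears on the crux (asymptotic), on `H3`, on the doors, or on `VP ≠ VNP`.
[folklore] Gap-rule / sieve bookkeeping plus a finite enumeration (postage-stamp numbers); no citation is load-bearing.
-/

-- `Summit.ValiantsHypothesis.ValiantsHypothesis.…` repeats a component by the D-0017 layout
-- (single-conjunct summit), which the `dupNamespace` linter flags; the name is mandated.
set_option linter.dupNamespace false

namespace Summit.ValiantsHypothesis.ValiantsHypothesis.Theorems.LacunarySymmetroidMatrixDescartes.FiniteSector

open scoped BigOperators Matrix
open Polynomial

/-! ## `(21,4)`: `σ(21,4) = 1610` — the transfer -/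


set_option maxRecDepth 4000 in
set_option maxHeartbeats 4000000 in
/-- **`η(21,4) ≤ 1610 = σ(21,4)`** — `HypRootLawAt 21 4 1610`: every in-sector (`#distinct real roots = natDegree`) determinant of a real symmetric
`21 × 21` lacunary pencil with `4` terms has degree `≤ 1610` (SIEVE ⇒ `21`-fold-sum chain; values capped at `1613`, padded, sorted; `a ≤ 2`, `b ≤ 21a + 2`;
prefix pruning; bitmasks; the slice checks). [folklore] -/
theorem hypRootLawAt_twentyone_four_1610 : HypRootLawAt 21 4 1610 := by
  intro d S hS hsec
  by_contra hdeg'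
  have hdeg : 1610 < (pencil d S).det.natDegree := not_le.mp hdeg'
  have hq : (pencil d S).det ≠ 0 := by
    intro h0
    rw [h0] at hdeg
    simp at hdeg
  have hpair : ∀ r, r ∈ (Finset.univ : Finset (Sym (Fin 4) 21)).image
      (fun s : Sym (Fin 4) 21 => ((s : Multiset (Fin 4)).map d).sum) → ∃ i j k l n o q i₁ j₁ k₁ l₁ n₁ o₁ q₁ i₂ j₂ k₂ l₂ n₂ o₂ q₂ : Fin 4, d i + d j + d k + d l + d n + d o + d q + d i₁ + d j₁ + d k₁ + d l₁ + d n₁ + d o₁ + d q₁ + d i₂ + d j₂ + d k₂ + d l₂ + d n₂ + d o₂ + d q₂ = r := by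
    intro r hr
    rw [Finset.mem_image] at hr
    obtain ⟨s, -, hs⟩ := hr
    obtain ⟨i, j, k, l, n, o, q, i₁, j₁, k₁, l₁, n₁, o₁, q₁, i₂, j₂, k₂, l₂, n₂, o₂, q₂, h21⟩ := exists_sum_eq_of_card_twentyone d (s : Multiset (Fin 4)) s.2
    exact ⟨i, j, k, l, n, o, q, i₁, j₁, k₁, l₁, n₁, o₁, q₁, i₂, j₂, k₂, l₂, n₂, o₂, q₂, by omega⟩
  have hchain : ∀ r, r + 2 ≤ (pencil d S).det.natDegree →
      (∃ i j k l n o q i₁ j₁ k₁ l₁ n₁ o₁ q₁ i₂ j₂ k₂ l₂ n₂ o₂ q₂ : Fin 4, d i + d j + d k + d l + d n + d o + d q + d i₁ + d j₁ + d k₁ + d l₁ + d n₁ + d o₁ + d q₁ + d i₂ + d j₂ + d k₂ + d l₂ + d n₂ + d o₂ + d q₂ = r) ∨ (∃ i j k l n o q i₁ j₁ k₁ l₁ n₁ o₁ q₁ i₂ j₂ k₂ l₂ n₂ o₂ q₂ : Fin 4, d i + d j + d k + d l + d n + d o + d q + d i₁ + d j₁ + d k₁ + d l₁ + d n₁ +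 d o₁ + d q₁ + d i₂ + d j₂ + d k₂ + d l₂ + d n₂ + d o₂ + d q₂ = r + 1) := by
    intro r hr
    rcases sieve d S hq hsec hr with h | h
    · exact Or.inl (hpair _ h)
    · exact Or.inr (hpair _ h)
  have htop : ∃ i j k l n o q i₁ j₁ k₁ l₁ n₁ o₁ q₁ i₂ j₂ k₂ l₂ n₂ o₂ q₂ : Fin 4, d i + d j + d k + d l + d n + d o + d q + d i₁ + d j₁ + d k₁ + d l₁ + d n₁ + d o₁ + d q₁ + d i₂ + d j₂ + d k₂ + d l₂ + d n₂ + d o₂ + d q₂ = (pencil d S).det.natDegree := hpair _ (natDegree_mem_sumset d S hq)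
  set cv : Fin 4 → ℕ := fun i => min (d i) 1613 with hcv
  have hcvd : ∀ i, d i ≤ 1612 → cv i = d i := fun i hi => by
    simp only [hcv]
    exact Nat.min_eq_left (by omega)
  have hcvle : ∀ i, cv i ≤ 1613 := fun i => Nat.min_le_right _ _
  set V : Finset ℕ := Finset.univ.image cv with hV
  have hcvV : ∀ i, cv i ∈ V := fun i => Finset.mem_image_of_mem cv (Finset.mem_univ i)
  have h0V : 0 ∈ V := by
    have key : ∃ i : Fin 4, d i = 0 := by
      rcases hchain 0 (by omega) with ⟨i, j, k, l, n, o, q, i₁, j₁, k₁, l₁, n₁, o₁, q₁, i₂, j₂, k₂, l₂, n₂, o₂, q₂, hh⟩ | ⟨i, j, k, l, n, o, q, i₁, j₁, k₁, l₁, n₁, o₁, q₁, i₂, j₂, k₂, l₂, n₂, o₂, q₂, hh⟩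
      · exact ⟨i, by omega⟩
      · rcases Nat.eq_zero_or_pos (d i) with hi | hi
        · exact ⟨i, hi⟩
        · exact ⟨j, by omega⟩
    obtain ⟨i, hi⟩ := key
    have : cv i = 0 := by rw [hcvd i (by omega)]; omega
    exact this ▸ hcvV i
  set W : Finset ℕ := V.erase 0 with hW
  have hWsub : W ⊆ (Finset.range 1614).erase 0 := by
    intro u hu
    rw [hW, Finset.mem_erase] at hu
    obtain ⟨hu0, huV⟩ := hu
    rw [hV, Finset.mem_image] at huV
    obtain ⟨i, -, rfl⟩ := huV
    rw [Finset.mem_erase, Finset.mem_range]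
    exact ⟨hu0, Nat.lt_succ_of_le (hcvle i)⟩
  have hWcard : W.card ≤ 3 := by
    have hVK : V.card ≤ 4 := by
      have := Finset.card_image_le (s := (Finset.univ : Finset (Fin 4))) (f := cv)
      simpa using this
    have h1 : W.card + 1 = V.card := by rw [hW]; exact Finset.card_erase_add_one h0V
    omega
  obtain ⟨W', hWW', hW'sub, hW'card⟩ := Finset.exists_subsuperset_card_eq hWsub hWcard
    (by rw [Finset.card_erase_of_mem (by simp), Finset.card_range]; omega)
  have hVW' : ∀ u ∈ V, u = 0 ∨ u ∈ W' := by
    intro u hu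
    by_cases hu0 : u = 0
    · exact Or.inl hu0
    · exact Or.inr (hWW' (by rw [hW, Finset.mem_erase]; exact ⟨hu0, hu⟩))
  have hlmem : ∀ u, u ∈ Finset.sort W' ↔ u ∈ W' := fun u => Finset.mem_sort _
  have hlsort : (Finset.sort W').SortedLT := Finset.sortedLT_sort W'
  have hllen : (Finset.sort W').length = 3 := by rw [Finset.length_sort, hW'card]
  generalize hl : Finset.sort W' = l at hlmem hlsort hllen
  rcases l with _ | ⟨a, _ | ⟨b, _ | ⟨c, _ | ⟨zz, ll⟩⟩⟩⟩
  all_goals simp only [List.length_cons, List.length_nil] at hllen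
  all_goals try omega
  have hmemR : ∀ u, u ∈ [a, b, c] → u ∈ List.range 1614 := by
    intro u hu
    have hu' : u ∈ W' := (hlmem u).mp hu
    have := hW'sub hu'
    rw [Finset.mem_erase, Finset.mem_range] at this
    exact List.mem_range.mpr this.2
  have hne0 : ∀ u, u ∈ [a, b, c] → u ≠ 0 := by
    intro u hu
    have hu' : u ∈ W' := (hlmem u).mp hu
    have := hW'sub hu'
    rw [Finset.mem_erase] at this
    exact this.1
  have h0 : 0 < a := Nat.pos_of_ne_zero (hne0 a (by simp))
  have hmemP : ∀ r, r ≤ 1612 → (∃ i j k l n o q i₁ j₁ k₁ l₁ n₁ o₁ q₁ i₂ j₂ k₂ l₂ n₂ o₂ q₂ : Fin 4, d i + d j + d k + d l + d n + d o + d q + d i₁ + d j₁ + d k₁ + d l₁ + d n₁ + d o₁ + d q₁ + d i₂ + d j₂ + d k₂ + d l₂ + d n₂ + d o₂ + d q₂ = r) → (∃ x ∈ [0, a, b, c], ∃ y ∈ [0, a, b, c], ∃ z ∈ [0, a, b, c], ∃ w ∈ [0, a, b, c], ∃ v ∈ [0, a, b, c], ∃ o ∈ [0, a, b, c], ∃ t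 ∈ [0, a, b, c], ∃ e₁ ∈ [0, a, b, c], ∃ e₂ ∈ [0, a, b, c], ∃ e₃ ∈ [0, a, b, c], ∃ e₄ ∈ [0, a, b, c], ∃ e₅ ∈ [0, a, b, c], ∃ e₆ ∈ [0, a, b, c], ∃ e₇ ∈ [0, a, b, c], ∃ e₈ ∈ [0, a, b, c], ∃ e₉ ∈ [0, a, b, c], ∃ e₁₀ ∈ [0, a, b, c], ∃ e₁₁ ∈ [0, a, b, c], ∃ e₁₂ ∈ [0, a, b, c], ∃ e₁₃ ∈ [0, a, b, c], ∃ e₁₄ ∈ [0, a, b, c], x + y + z + w + v + o + t + e₁ + e₂ + e₃ + e₄ + e₅ + e₆ + e₇ + e₈ + e₉ + e₁₀ + e₁₁ + e₁₂ + e₁₃ + e₁₄ = r) := by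
    rintro r hr ⟨i, j, k, l, n, o, q, i₁, j₁, k₁, l₁, n₁, o₁, q₁, i₂, j₂, k₂, l₂, n₂, o₂, q₂, hsum⟩
    have hi : cv i = d i := hcvd i (by omega)
    have hj : cv j = d j := hcvd j (by omega)
    have hk : cv k = d k := hcvd k (by omega)
    have hl : cv l = d l := hcvd l (by omega)
    have hn : cv n = d n := hcvd n (by omega)
    have ho : cv o = d o := hcvd o (by omega)
    have hq : cv q = d q := hcvd q (by omega)
    have hi₁ : cv i₁ = d i₁ := hcvd i₁ (by omega)
    have hj₁ : cv j₁ = d j₁ := hcvd j₁ (by omega)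
    have hk₁ : cv k₁ = d k₁ := hcvd k₁ (by omega)
    have hl₁ : cv l₁ = d l₁ := hcvd l₁ (by omega)
    have hn₁ : cv n₁ = d n₁ := hcvd n₁ (by omega)
    have ho₁ : cv o₁ = d o₁ := hcvd o₁ (by omega)
    have hq₁ : cv q₁ = d q₁ := hcvd q₁ (by omega)
    have hi₂ : cv i₂ = d i₂ := hcvd i₂ (by omega)
    have hj₂ : cv j₂ = d j₂ := hcvd j₂ (by omega)
    have hk₂ : cv k₂ = d k₂ := hcvd k₂ (by omega)
    have hl₂ : cv l₂ = d l₂ := hcvd l₂ (by omega)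
    have hn₂ : cv n₂ = d n₂ := hcvd n₂ (by omega)
    have ho₂ : cv o₂ = d o₂ := hcvd o₂ (by omega)
    have hq₂ : cv q₂ = d q₂ := hcvd q₂ (by omega)
    have hin : ∀ u ∈ V, u ∈ [0, a, b, c] := by
      intro u hu
      rcases hVW' u hu with h | h
      · rw [h]; simp
      · exact List.mem_cons_of_mem _ ((hlmem u).mpr h)
    exact ⟨cv i, hin _ (hcvV i), cv j, hin _ (hcvV j), cv k, hin _ (hcvV k), cv l, hin _ (hcvV l), cv n, hin _ (hcvV n), cv o, hin _ (hcvV o), cv q, hin _ (hcvV q), cv i₁, hin _ (hcvV i₁), cv j₁, hin _ (hcvV j₁), cv k₁, hin _ (hcvV k₁), cv l₁, hin _ (hcvV l₁), cv n₁, hin _ (hcvV n₁), cv o₁, hin _ (hcvV o₁), cv q₁, hin _ (hcvV q₁), cv i₂, hin _ (hcvV i₂), cv j₂, hin _ (hcvV j₂), cv k₂, hin _ (hcvV k₂), cv l₂, hin _ (hcvV l₂), cv n₂, hin _ (hcvV n₂), cv o₂, hin _ (hcvV o₂), cv q₂, hin _ (hcvV q₂), by rw [hi, hj, hk, hl, hn,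 ho, hq, hi₁, hj₁, hk₁, hl₁, hn₁, ho₁, hq₁, hi₂, hj₂, hk₂, hl₂, hn₂, ho₂, hq₂]; exact hsum⟩
  have hchainP : ∀ r, r ≤ 1609 → (∃ x ∈ [0, a, b, c], ∃ y ∈ [0, a, b, c], ∃ z ∈ [0, a, b, c], ∃ w ∈ [0, a, b, c], ∃ v ∈ [0, a, b, c], ∃ o ∈ [0, a, b, c], ∃ t ∈ [0, a, b, c], ∃ e₁ ∈ [0, a, b, c], ∃ e₂ ∈ [0, a, b, c], ∃ e₃ ∈ [0, a, b, c], ∃ e₄ ∈ [0, a, b, c], ∃ e₅ ∈ [0, a, b, c], ∃ e₆ ∈ [0, a, b, c], ∃ e₇ ∈ [0, a, b, c], ∃ e₈ ∈ [0, a, b, c], ∃ e₉ ∈ [0, a, b, c], ∃ e₁₀ ∈ [0, a, b, c], ∃ e₁₁ ∈ [0, a, b, c], ∃ e₁₂ ∈ [0, a, b, c], ∃ e₁₃ ∈ [0, a, b, c], ∃ e₁₄ ∈ [0, a, b, c], x + y + z + w + v + o + t + e₁ + e₂ + e₃ + e₄ + e₅ + e₆ + e₇ + e₈ + e₉ + e₁₀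 + e₁₁ + e₁₂ + e₁₃ + e₁₄ = r) ∨ (∃ x ∈ [0, a, b, c], ∃ y ∈ [0, a, b, c], ∃ z ∈ [0, a, b, c], ∃ w ∈ [0, a, b, c], ∃ v ∈ [0, a, b, c], ∃ o ∈ [0, a, b, c], ∃ t ∈ [0, a, b, c], ∃ e₁ ∈ [0, a, b, c], ∃ e₂ ∈ [0, a, b, c], ∃ e₃ ∈ [0, a, b, c], ∃ e₄ ∈ [0, a, b, c], ∃ e₅ ∈ [0, a, b, c], ∃ e₆ ∈ [0, a, b, c], ∃ e₇ ∈ [0, a, b, c], ∃ e₈ ∈ [0, a, b, c], ∃ e₉ ∈ [0, a, b, c], ∃ e₁₀ ∈ [0, a, b, c], ∃ e₁₁ ∈ [0, a, b, c], ∃ e₁₂ ∈ [0, a, b, c], ∃ e₁₃ ∈ [0, a, b, c], ∃ e₁₄ ∈ [0, a, b, c], x + y + z + w + v + o + t + e₁ + e₂ + e₃ + e₄ + e₅ + e₆ + e₇ + e₈ + e₉ + e₁₀ + e₁₁ + e₁₂ + e₁₃ + e₁₄ = r + 1) := by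
    intro r hr
    rcases hchain r (by omega) with h | h
    · exact Or.inl (hmemP r (by clear h; omega) h)
    · exact Or.inr (hmemP (r + 1) (by clear h; omega) h)
  have hfull : ((List.foldr (fun (x acc : ℕ) => acc ||| (List.foldr (fun (x acc : ℕ) => acc ||| (List.foldr (fun (x acc : ℕ) => acc ||| (List.foldr (fun (x acc : ℕ) => acc ||| (List.foldr (fun (x acc : ℕ) => acc ||| (List.foldr (fun (x acc : ℕ) => acc ||| (List.foldr (fun (x acc : ℕ) => acc ||| (List.foldr (fun (x acc : ℕ) => acc ||| (List.foldr (fun (x acc : ℕ) => acc ||| (List.foldr (fun (x acc : ℕ) => acc ||| (List.foldr (fun (x acc : ℕ) => acc ||| (List.foldr (fun (x acc : ℕ) => acc ||| (List.foldr (fun (x acc : ℕ) => acc ||| (List.foldr (fun (x acc : ℕ) => acc ||| (List.foldr (fun (x acc : ℕ) => acc ||| (List.foldr (fun (x acc : ℕ) => acc ||| (List.foldr (fun (x acc : ℕ) => acc ||| (List.foldr (fun (x acc : ℕ) => acc ||| (List.foldr (fun (x acc : ℕ) => acc ||| (List.foldr (fun (x acc : ℕ) => acc ||| (List.foldr (fun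 (y acc : ℕ) => acc ||| 2 ^ y) 0 [0, a, b, c]) * 2 ^ x) 0 [0, a, b, c]) * 2 ^ x) 0 [0, a, b, c]) * 2 ^ x) 0 [0, a, b, c]) * 2 ^ x) 0 [0, a, b, c]) * 2 ^ x) 0 [0, a, b, c]) * 2 ^ x) 0 [0, a, b, c]) * 2 ^ x) 0 [0, a, b, c]) * 2 ^ x) 0 [0, a, b, c]) * 2 ^ x) 0 [0, a, b, c]) * 2 ^ x) 0 [0, a, b, c]) * 2 ^ x) 0 [0, a, b, c]) * 2 ^ x) 0 [0, a, b, c]) * 2 ^ x) 0 [0, a, b, c]) * 2 ^ x) 0 [0, a, b, c]) * 2 ^ x) 0 [0, a, b, c]) * 2 ^ x) 0 [0, a, b, c]) * 2 ^ x) 0 [0, a, b, c]) * 2 ^ x) 0 [0, a, b, c]) * 2 ^ x) 0 [0, a, b, c]) * 2 ^ x) 0 [0, a, b, c] ||| List.foldr (fun (x acc : ℕ) => acc ||| (List.foldr (fun (x acc : ℕ) => acc ||| (List.foldr (fun (x acc : ℕ) => acc ||| (List.foldr (fun (x acc : ℕ) => acc ||| (List.foldr (fun (x acc : ℕ) =>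 acc ||| (List.foldr (fun (x acc : ℕ) => acc ||| (List.foldr (fun (x acc : ℕ) => acc ||| (List.foldr (fun (x acc : ℕ) => acc ||| (List.foldr (fun (x acc : ℕ) => acc ||| (List.foldr (fun (x acc : ℕ) => acc ||| (List.foldr (fun (x acc : ℕ) => acc ||| (List.foldr (fun (x acc : ℕ) => acc ||| (List.foldr (fun (x acc : ℕ) => acc ||| (List.foldr (fun (x acc : ℕ) => acc ||| (List.foldr (fun (x acc : ℕ) => acc ||| (List.foldr (fun (x acc : ℕ) => acc ||| (List.foldr (fun (x acc : ℕ) => acc ||| (List.foldr (fun (x acc : ℕ) => acc ||| (List.foldr (fun (x acc : ℕ) => acc ||| (List.foldr (fun (x acc : ℕ) => acc ||| (List.foldr (fun (y acc : ℕ) => acc ||| 2 ^ y) 0 [0, a, b, c]) * 2 ^ x) 0 [0, a, b, c]) * 2 ^ x) 0 [0, a, b, c]) * 2 ^ x) 0 [0, a, b, c]) * 2 ^ x) 0 [0, a, b, c]) * 2 ^ x) 0 [0, a, b, c]) * 2 ^ x) 0 [0, a, b, c]) * 2 ^ x) 0 [0, a, b, c]) * 2 ^ x) 0 [0, a, b,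 c]) * 2 ^ x) 0 [0, a, b, c]) * 2 ^ x) 0 [0, a, b, c]) * 2 ^ x) 0 [0, a, b, c]) * 2 ^ x) 0 [0, a, b, c]) * 2 ^ x) 0 [0, a, b, c]) * 2 ^ x) 0 [0, a, b, c]) * 2 ^ x) 0 [0, a, b, c]) * 2 ^ x) 0 [0, a, b, c]) * 2 ^ x) 0 [0, a, b, c]) * 2 ^ x) 0 [0, a, b, c]) * 2 ^ x) 0 [0, a, b, c]) * 2 ^ x) 0 [0, a, b, c] / 2) % 2 ^ 1610 = 2 ^ 1610 - 1) := by
    apply maskAlive_of_testBit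
    intro r hr
    rcases hchainP r (by omega) with h | h
    · exact Or.inl (testBit_fold21Shift_of_mem h)
    · exact Or.inr (testBit_fold21Shift_of_mem h)
  have hlt1 : a < b := by
    have := hlsort (show (⟨0, by simp⟩ : Fin [a, b, c].length) < ⟨1, by simp⟩ from Fin.mk_lt_mk.mpr (by norm_num))
    simpa using this
  have hlt2 : b < c := by
    have := hlsort (show (⟨1, by simp⟩ : Fin [a, b, c].length) < ⟨2, by simp⟩ from Fin.mk_lt_mk.mpr (by norm_num))
    simpa using this
  -- the two smallest positive values: `a ≤ 2` (chain at `1`) and `b ≤ 21a + 2` (chain at `21a + 1`)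
  have hrestA : ∀ y ∈ [a, b, c], a ≤ y := by
    clear hfull
    intro y hy
    simp only [List.mem_cons, List.mem_nil_iff, or_false] at hy
    omega
  have hrestB : ∀ y ∈ [b, c], b ≤ y := by
    clear hfull
    intro y hy
    simp only [List.mem_cons, List.mem_nil_iff, or_false] at hy
    omega
  have ha2 : a ≤ 2 := by
    clear hfull
    by_contra hh
    rcases hchainP 1 (by omega) with h | h
    · obtain ⟨x, hx, y, hy, z, hz, w, hw, v, hv, o, ho, t, ht, e₁, he₁, e₂, he₂, e₃, he₃, e₄, he₄, e₅, he₅, e₆, he₆, e₇, he₇, e₈, he₈, e₉, he₉, e₁₀, he₁₀, e₁₁, he₁₁, e₁₂, he₁₂, e₁₃, he₁₃, e₁₄, he₁₄, hsum⟩ := memP21_prefix (l₁ := [0]) (l₂ := [a, b, c]) hrestA (by omega) h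
      simp only [List.mem_cons, List.mem_nil_iff, or_false] at hx hy hz hw hv ho ht he₁ he₂ he₃ he₄ he₅ he₆ he₇ he₈ he₉ he₁₀ he₁₁ he₁₂ he₁₃ he₁₄
      omega
    · obtain ⟨x, hx, y, hy, z, hz, w, hw, v, hv, o, ho, t, ht, e₁, he₁, e₂, he₂, e₃, he₃, e₄, he₄, e₅, he₅, e₆, he₆, e₇, he₇, e₈, he₈, e₉, he₉, e₁₀, he₁₀, e₁₁, he₁₁, e₁₂, he₁₂, e₁₃, he₁₃, e₁₄, he₁₄, hsum⟩ := memP21_prefix (l₁ := [0]) (l₂ := [a, b, c]) hrestA (by omega) h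
      simp only [List.mem_cons, List.mem_nil_iff, or_false] at hx hy hz hw hv ho ht he₁ he₂ he₃ he₄ he₅ he₆ he₇ he₈ he₉ he₁₀ he₁₁ he₁₂ he₁₃ he₁₄
      omega
  have hb2 : b ≤ 21 * a + 2 := by
    clear hfull
    by_contra hh
    rcases hchainP (21 * a + 1) (by omega) with h | h
    · obtain ⟨x, hx, y, hy, z, hz, w, hw, v, hv, o, ho, t, ht, e₁, he₁, e₂, he₂, e₃, he₃, e₄, he₄, e₅, he₅, e₆, he₆, e₇, he₇, e₈, he₈, e₉, he₉, e₁₀, he₁₀, e₁₁, he₁₁, e₁₂, he₁₂, e₁₃, he₁₃, e₁₄, he₁₄, hsum⟩ := memP21_prefix (l₁ := [0, a]) (l₂ := [b, c]) hrestB (by omega) h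
      simp only [List.mem_cons, List.mem_nil_iff, or_false] at hx hy hz hw hv ho ht he₁ he₂ he₃ he₄ he₅ he₆ he₇ he₈ he₉ he₁₀ he₁₁ he₁₂ he₁₃ he₁₄
      have hx' : x ≤ a := by rcases hx with hh0 | hh0 <;> omega
      have hy' : y ≤ a := by rcases hy with hh0 | hh0 <;> omega
      have hz' : z ≤ a := by rcases hz with hh0 | hh0 <;> omega
      have hw' : w ≤ a := by rcases hw with hh0 | hh0 <;> omega
      have hv' : v ≤ a := by rcases hv with hh0 | hh0 <;> omega
      have ho' : o ≤ a := by rcases ho with hh0 | hh0 <;> omega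
      have ht' : t ≤ a := by rcases ht with hh0 | hh0 <;> omega
      have he₁' : e₁ ≤ a := by rcases he₁ with hh0 | hh0 <;> omega
      have he₂' : e₂ ≤ a := by rcases he₂ with hh0 | hh0 <;> omega
      have he₃' : e₃ ≤ a := by rcases he₃ with hh0 | hh0 <;> omega
      have he₄' : e₄ ≤ a := by rcases he₄ with hh0 | hh0 <;> omega
      have he₅' : e₅ ≤ a := by rcases he₅ with hh0 | hh0 <;> omega
      have he₆' : e₆ ≤ a := by rcases he₆ with hh0 | hh0 <;> omega
      have he₇' : e₇ ≤ a := by rcases he₇ with hh0 | hh0 <;> omega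
      have he₈' : e₈ ≤ a := by rcases he₈ with hh0 | hh0 <;> omega
      have he₉' : e₉ ≤ a := by rcases he₉ with hh0 | hh0 <;> omega
      have he₁₀' : e₁₀ ≤ a := by rcases he₁₀ with hh0 | hh0 <;> omega
      have he₁₁' : e₁₁ ≤ a := by rcases he₁₁ with hh0 | hh0 <;> omega
      have he₁₂' : e₁₂ ≤ a := by rcases he₁₂ with hh0 | hh0 <;> omega
      have he₁₃' : e₁₃ ≤ a := by rcases he₁₃ with hh0 | hh0 <;> omega
      have he₁₄' : e₁₄ ≤ a := by rcases he₁₄ with hh0 | hh0 <;> omega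
      omega
    · obtain ⟨x, hx, y, hy, z, hz, w, hw, v, hv, o, ho, t, ht, e₁, he₁, e₂, he₂, e₃, he₃, e₄, he₄, e₅, he₅, e₆, he₆, e₇, he₇, e₈, he₈, e₉, he₉, e₁₀, he₁₀, e₁₁, he₁₁, e₁₂, he₁₂, e₁₃, he₁₃, e₁₄, he₁₄, hsum⟩ := memP21_prefix (l₁ := [0, a]) (l₂ := [b, c]) hrestB (by omega) h
      simp only [List.mem_cons, List.mem_nil_iff, or_false] at hx hy hz hw hv ho ht he₁ he₂ he₃ he₄ he₅ he₆ he₇ he₈ he₉ he₁₀ he₁₁ he₁₂ he₁₃ he₁₄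
      have hx' : x ≤ a := by rcases hx with hh0 | hh0 <;> omega
      have hy' : y ≤ a := by rcases hy with hh0 | hh0 <;> omega
      have hz' : z ≤ a := by rcases hz with hh0 | hh0 <;> omega
      have hw' : w ≤ a := by rcases hw with hh0 | hh0 <;> omega
      have hv' : v ≤ a := by rcases hv with hh0 | hh0 <;> omega
      have ho' : o ≤ a := by rcases ho with hh0 | hh0 <;> omega
      have ht' : t ≤ a := by rcases ht with hh0 | hh0 <;> omega
      have he₁' : e₁ ≤ a := by rcases he₁ with hh0 | hh0 <;> omega
      have he₂' : e₂ ≤ a := by rcases he₂ with hh0 | hh0 <;> omega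
      have he₃' : e₃ ≤ a := by rcases he₃ with hh0 | hh0 <;> omega
      have he₄' : e₄ ≤ a := by rcases he₄ with hh0 | hh0 <;> omega
      have he₅' : e₅ ≤ a := by rcases he₅ with hh0 | hh0 <;> omega
      have he₆' : e₆ ≤ a := by rcases he₆ with hh0 | hh0 <;> omega
      have he₇' : e₇ ≤ a := by rcases he₇ with hh0 | hh0 <;> omega
      have he₈' : e₈ ≤ a := by rcases he₈ with hh0 | hh0 <;> omega
      have he₉' : e₉ ≤ a := by rcases he₉ with hh0 | hh0 <;> omega
      have he₁₀' : e₁₀ ≤ a := by rcases he₁₀ with hh0 | hh0 <;> omega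
      have he₁₁' : e₁₁ ≤ a := by rcases he₁₁ with hh0 | hh0 <;> omega
      have he₁₂' : e₁₂ ≤ a := by rcases he₁₂ with hh0 | hh0 <;> omega
      have he₁₃' : e₁₃ ≤ a := by rcases he₁₃ with hh0 | hh0 <;> omega
      have he₁₄' : e₁₄ ≤ a := by rcases he₁₄ with hh0 | hh0 <;> omega
      omega
  have pre3 : ((List.foldr (fun (x acc : ℕ) => acc ||| (List.foldr (fun (x acc : ℕ) => acc ||| (List.foldr (fun (x acc : ℕ) => acc ||| (List.foldr (fun (x acc : ℕ) => acc ||| (List.foldr (fun (x acc : ℕ) => acc ||| (List.foldr (fun (x acc : ℕ) => acc ||| (List.foldr (fun (x acc : ℕ) => acc ||| (List.foldr (fun (x acc : ℕ) => acc ||| (List.foldr (fun (x acc : ℕ) => acc ||| (List.foldr (fun (x acc : ℕ) => acc ||| (List.foldr (fun (x acc : ℕ) => acc ||| (List.foldr (fun (x acc : ℕ) => acc ||| (List.foldr (fun (x acc : ℕ) => acc ||| (List.foldr (fun (x acc : ℕ) => acc ||| (List.foldr (fun (x acc : ℕ) => acc ||| (List.foldr (fun (x acc : ℕ) => acc |||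 (List.foldr (fun (x acc : ℕ) => acc ||| (List.foldr (fun (x acc : ℕ) => acc ||| (List.foldr (fun (x acc : ℕ) => acc ||| (List.foldr (fun (x acc : ℕ) => acc ||| (List.foldr (fun (y acc : ℕ) => acc ||| 2 ^ y) 0 [0, a, b]) * 2 ^ x) 0 [0, a, b]) * 2 ^ x) 0 [0, a, b]) * 2 ^ x) 0 [0, a, b]) * 2 ^ x) 0 [0, a, b]) * 2 ^ x) 0 [0, a, b]) * 2 ^ x) 0 [0, a, b]) * 2 ^ x) 0 [0, a, b]) * 2 ^ x) 0 [0, a, b]) * 2 ^ x) 0 [0, a, b]) * 2 ^ x) 0 [0, a, b]) * 2 ^ x) 0 [0, a, b]) * 2 ^ x) 0 [0, a, b]) * 2 ^ x) 0 [0, a, b]) * 2 ^ x) 0 [0, a, b]) * 2 ^ x) 0 [0, a, b]) * 2 ^ x) 0 [0, a, b]) * 2 ^ x) 0 [0, a, b]) * 2 ^ x) 0 [0, a, b]) * 2 ^ x) 0 [0, a, b]) * 2 ^ x) 0 [0, a, b] ||| List.foldr (fun (x acc : ℕ) => acc ||| (List.foldr (fun (x acc : ℕ) => acc ||| (List.foldr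 (fun (x acc : ℕ) => acc ||| (List.foldr (fun (x acc : ℕ) => acc ||| (List.foldr (fun (x acc : ℕ) => acc ||| (List.foldr (fun (x acc : ℕ) => acc ||| (List.foldr (fun (x acc : ℕ) => acc ||| (List.foldr (fun (x acc : ℕ) => acc ||| (List.foldr (fun (x acc : ℕ) => acc ||| (List.foldr (fun (x acc : ℕ) => acc ||| (List.foldr (fun (x acc : ℕ) => acc ||| (List.foldr (fun (x acc : ℕ) => acc ||| (List.foldr (fun (x acc : ℕ) => acc ||| (List.foldr (fun (x acc : ℕ) => acc ||| (List.foldr (fun (x acc : ℕ) => acc ||| (List.foldr (fun (x acc : ℕ) => acc ||| (List.foldr (fun (x acc : ℕ) => acc ||| (List.foldr (fun (x acc : ℕ) => acc ||| (List.foldr (fun (x acc : ℕ) => acc ||| (List.foldr (fun (x acc : ℕ) => acc ||| (List.foldr (fun (y acc : ℕ) => acc ||| 2 ^ y) 0 [0, a, b]) * 2 ^ x) 0 [0, a, b]) * 2 ^ x) 0 [0, a, b]) * 2 ^ x) 0 [0, a, b]) * 2 ^ x) 0 [0, a, b]) * 2 ^ x) 0 [0, a, b]) * 2 ^ x) 0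 [0, a, b]) * 2 ^ x) 0 [0, a, b]) * 2 ^ x) 0 [0, a, b]) * 2 ^ x) 0 [0, a, b]) * 2 ^ x) 0 [0, a, b]) * 2 ^ x) 0 [0, a, b]) * 2 ^ x) 0 [0, a, b]) * 2 ^ x) 0 [0, a, b]) * 2 ^ x) 0 [0, a, b]) * 2 ^ x) 0 [0, a, b]) * 2 ^ x) 0 [0, a, b]) * 2 ^ x) 0 [0, a, b]) * 2 ^ x) 0 [0, a, b]) * 2 ^ x) 0 [0, a, b]) * 2 ^ x) 0 [0, a, b] / 2) % 2 ^ (min 1610 (c - 1)) = 2 ^ (min 1610 (c - 1)) - 1) := by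
    clear hfull
    apply maskAlive_of_testBit
    intro r hr
    have hrT : r < 1610 := lt_of_lt_of_le hr (min_le_left _ _)
    have hrv : r < c - 1 := lt_of_lt_of_le hr (min_le_right _ _)
    have hr' : r + 1 < c := by omega
    have hrest : ∀ y ∈ [c], c ≤ y := by
      intro y hy
      simp only [List.mem_cons, List.mem_nil_iff, or_false] at hy
      omega
    rcases hchainP r (by omega) with h | h
    · exact Or.inl (testBit_fold21Shift_of_mem (memP21_prefix (l₁ := [0, a, b]) (l₂ := [c]) hrest (by omega) h))
    · exact Or.inr (testBit_fold21Shift_of_mem (memP21_prefix (l₁ := [0, a, b]) (l₂ := [c]) hrest hr' h))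
  obtain ⟨hnoT1, hnoT0T2⟩ :
      ((List.foldr (fun (x acc : ℕ) => acc ||| (List.foldr (fun (x acc : ℕ) => acc ||| (List.foldr (fun (x acc : ℕ) => acc ||| (List.foldr (fun (x acc : ℕ) => acc ||| (List.foldr (fun (x acc : ℕ) => acc ||| (List.foldr (fun (x acc : ℕ) => acc ||| (List.foldr (fun (x acc : ℕ) => acc ||| (List.foldr (fun (x acc : ℕ) => acc ||| (List.foldr (fun (x acc : ℕ) => acc ||| (List.foldr (fun (x acc : ℕ) => acc ||| (List.foldr (fun (x acc : ℕ) => acc ||| (List.foldr (fun (x acc : ℕ) => acc ||| (List.foldr (fun (x acc : ℕ) => acc ||| (List.foldr (fun (x acc : ℕ) => acc ||| (List.foldr (fun (x acc : ℕ) => acc ||| (List.foldr (fun (x acc : ℕ) => acc ||| (List.foldr (fun (x acc : ℕ) => acc ||| (List.foldr (fun (x acc : ℕ) => acc ||| (List.foldr (fun (x acc : ℕ) => acc ||| (List.foldr (fun (x acc : ℕ) => acc ||| (List.foldr (fun (y acc : ℕ) => acc ||| 2 ^ y) 0 [0, a, b, c]) * 2 ^ x) 0 [0, a, b, c]) * 2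 ^ x) 0 [0, a, b, c]) * 2 ^ x) 0 [0, a, b, c]) * 2 ^ x) 0 [0, a, b, c]) * 2 ^ x) 0 [0, a, b, c]) * 2 ^ x) 0 [0, a, b, c]) * 2 ^ x) 0 [0, a, b, c]) * 2 ^ x) 0 [0, a, b, c]) * 2 ^ x) 0 [0, a, b, c]) * 2 ^ x) 0 [0, a, b, c]) * 2 ^ x) 0 [0, a, b, c]) * 2 ^ x) 0 [0, a, b, c]) * 2 ^ x) 0 [0, a, b, c]) * 2 ^ x) 0 [0, a, b, c]) * 2 ^ x) 0 [0, a, b, c]) * 2 ^ x) 0 [0, a, b, c]) * 2 ^ x) 0 [0, a, b, c]) * 2 ^ x) 0 [0, a, b, c]) * 2 ^ x) 0 [0, a, b, c]) * 2 ^ x) 0 [0, a, b, c]).testBit 1611 = false ∧ ((List.foldr (fun (x acc : ℕ) => acc ||| (List.foldr (fun (x acc : ℕ) => acc ||| (List.foldr (fun (x acc : ℕ) => acc ||| (List.foldr (fun (x acc : ℕ) => acc ||| (List.foldr (fun (x acc : ℕ) => acc ||| (List.foldr (fun (x acc : ℕ) => acc ||| (List.foldr (fun (x acc : ℕ) =>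 acc ||| (List.foldr (fun (x acc : ℕ) => acc ||| (List.foldr (fun (x acc : ℕ) => acc ||| (List.foldr (fun (x acc : ℕ) => acc ||| (List.foldr (fun (x acc : ℕ) => acc ||| (List.foldr (fun (x acc : ℕ) => acc ||| (List.foldr (fun (x acc : ℕ) => acc ||| (List.foldr (fun (x acc : ℕ) => acc ||| (List.foldr (fun (x acc : ℕ) => acc ||| (List.foldr (fun (x acc : ℕ) => acc ||| (List.foldr (fun (x acc : ℕ) => acc ||| (List.foldr (fun (x acc : ℕ) => acc ||| (List.foldr (fun (x acc : ℕ) => acc ||| (List.foldr (fun (x acc : ℕ) => acc ||| (List.foldr (fun (y acc : ℕ) => acc ||| 2 ^ y) 0 [0, a, b, c]) * 2 ^ x) 0 [0, a, b, c]) * 2 ^ x) 0 [0, a, b, c]) * 2 ^ x) 0 [0, a, b, c]) * 2 ^ x) 0 [0, a, b, c]) * 2 ^ x) 0 [0, a, b, c]) * 2 ^ x) 0 [0, a, b, c]) * 2 ^ x) 0 [0, a, b, c]) * 2 ^ x) 0 [0, a, b, c]) * 2 ^ x) 0 [0, a, b, c]) * 2 ^ x) 0 [0, a, b, c]) * 2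 ^ x) 0 [0, a, b, c]) * 2 ^ x) 0 [0, a, b, c]) * 2 ^ x) 0 [0, a, b, c]) * 2 ^ x) 0 [0, a, b, c]) * 2 ^ x) 0 [0, a, b, c]) * 2 ^ x) 0 [0, a, b, c]) * 2 ^ x) 0 [0, a, b, c]) * 2 ^ x) 0 [0, a, b, c]) * 2 ^ x) 0 [0, a, b, c]) * 2 ^ x) 0 [0, a, b, c]).testBit 1610 = false ∨ (List.foldr (fun (x acc : ℕ) => acc ||| (List.foldr (fun (x acc : ℕ) => acc ||| (List.foldr (fun (x acc : ℕ) => acc ||| (List.foldr (fun (x acc : ℕ) => acc ||| (List.foldr (fun (x acc : ℕ) => acc ||| (List.foldr (fun (x acc : ℕ) => acc ||| (List.foldr (fun (x acc : ℕ) => acc ||| (List.foldr (fun (x acc : ℕ) => acc ||| (List.foldr (fun (x acc : ℕ) => acc ||| (List.foldr (fun (x acc : ℕ) => acc ||| (List.foldr (fun (x acc : ℕ) => acc ||| (List.foldr (fun (x acc : ℕ) => acc ||| (List.foldr (fun (x acc : ℕ) => acc ||| (List.foldr (fun (x acc : ℕ) => acc ||| (List.foldr (fun (x acc : ℕ) =>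 acc ||| (List.foldr (fun (x acc : ℕ) => acc ||| (List.foldr (fun (x acc : ℕ) => acc ||| (List.foldr (fun (x acc : ℕ) => acc ||| (List.foldr (fun (x acc : ℕ) => acc ||| (List.foldr (fun (x acc : ℕ) => acc ||| (List.foldr (fun (y acc : ℕ) => acc ||| 2 ^ y) 0 [0, a, b, c]) * 2 ^ x) 0 [0, a, b, c]) * 2 ^ x) 0 [0, a, b, c]) * 2 ^ x) 0 [0, a, b, c]) * 2 ^ x) 0 [0, a, b, c]) * 2 ^ x) 0 [0, a, b, c]) * 2 ^ x) 0 [0, a, b, c]) * 2 ^ x) 0 [0, a, b, c]) * 2 ^ x) 0 [0, a, b, c]) * 2 ^ x) 0 [0, a, b, c]) * 2 ^ x) 0 [0, a, b, c]) * 2 ^ x) 0 [0, a, b, c]) * 2 ^ x) 0 [0, a, b, c]) * 2 ^ x) 0 [0, a, b, c]) * 2 ^ x) 0 [0, a, b, c]) * 2 ^ x) 0 [0, a, b, c]) * 2 ^ x) 0 [0, a, b, c]) * 2 ^ x) 0 [0, a, b, c]) * 2 ^ x) 0 [0, a, b, c]) * 2 ^ x) 0 [0, a, b, c]) * 2 ^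 x) 0 [0, a, b, c]).testBit 1612 = false)) := by
    interval_cases a <;> interval_cases b
    · exact sectorCheck_twentyone_four_s12 c (hmemR c (by simp)) ⟨hlt2, pre3⟩ hfull
    · exact sectorCheck_twentyone_four_s13 c (hmemR c (by simp)) ⟨hlt2, pre3⟩ hfull
    · exact sectorCheck_twentyone_four_s14 c (hmemR c (by simp)) ⟨hlt2, pre3⟩ hfull
    · exact sectorCheck_twentyone_four_s15 c (hmemR c (by simp)) ⟨hlt2, pre3⟩ hfull
    · exact sectorCheck_twentyone_four_s16 c (hmemR c (by simp)) ⟨hlt2, pre3⟩ hfull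
    · exact sectorCheck_twentyone_four_s17 c (hmemR c (by simp)) ⟨hlt2, pre3⟩ hfull
    · exact sectorCheck_twentyone_four_s18 c (hmemR c (by simp)) ⟨hlt2, pre3⟩ hfull
    · exact sectorCheck_twentyone_four_s19 c (hmemR c (by simp)) ⟨hlt2, pre3⟩ hfull
    · exact sectorCheck_twentyone_four_s110 c (hmemR c (by simp)) ⟨hlt2, pre3⟩ hfull
    · exact sectorCheck_twentyone_four_s111 c (hmemR c (by simp)) ⟨hlt2, pre3⟩ hfull
    · exact sectorCheck_twentyone_four_s112 c (hmemR c (by simp)) ⟨hlt2, pre3⟩ hfull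
    · exact sectorCheck_twentyone_four_s113 c (hmemR c (by simp)) ⟨hlt2, pre3⟩ hfull
    · exact sectorCheck_twentyone_four_s114 c (hmemR c (by simp)) ⟨hlt2, pre3⟩ hfull
    · exact sectorCheck_twentyone_four_s115 c (hmemR c (by simp)) ⟨hlt2, pre3⟩ hfull
    · exact sectorCheck_twentyone_four_s116 c (hmemR c (by simp)) ⟨hlt2, pre3⟩ hfull
    · exact sectorCheck_twentyone_four_s117 c (hmemR c (by simp)) ⟨hlt2, pre3⟩ hfull
    · exact sectorCheck_twentyone_four_s118 c (hmemR c (by simp)) ⟨hlt2, pre3⟩ hfull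
    · exact sectorCheck_twentyone_four_s119 c (hmemR c (by simp)) ⟨hlt2, pre3⟩ hfull
    · exact sectorCheck_twentyone_four_s120 c (hmemR c (by simp)) ⟨hlt2, pre3⟩ hfull
    · exact sectorCheck_twentyone_four_s121 c (hmemR c (by simp)) ⟨hlt2, pre3⟩ hfull
    · exact sectorCheck_twentyone_four_s122 c (hmemR c (by simp)) ⟨hlt2, pre3⟩ hfull
    · exact sectorCheck_twentyone_four_s123 c (hmemR c (by simp)) ⟨hlt2, pre3⟩ hfull
    · exact sectorCheck_twentyone_four_s23 c (hmemR c (by simp)) ⟨hlt2, pre3⟩ hfull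
    · exact sectorCheck_twentyone_four_s24 c (hmemR c (by simp)) ⟨hlt2, pre3⟩ hfull
    · exact sectorCheck_twentyone_four_s25 c (hmemR c (by simp)) ⟨hlt2, pre3⟩ hfull
    · exact sectorCheck_twentyone_four_s26 c (hmemR c (by simp)) ⟨hlt2, pre3⟩ hfull
    · exact sectorCheck_twentyone_four_s27 c (hmemR c (by simp)) ⟨hlt2, pre3⟩ hfull
    · exact sectorCheck_twentyone_four_s28 c (hmemR c (by simp)) ⟨hlt2, pre3⟩ hfull
    · exact sectorCheck_twentyone_four_s29 c (hmemR c (by simp)) ⟨hlt2, pre3⟩ hfull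
    · exact sectorCheck_twentyone_four_s210 c (hmemR c (by simp)) ⟨hlt2, pre3⟩ hfull
    · exact sectorCheck_twentyone_four_s211 c (hmemR c (by simp)) ⟨hlt2, pre3⟩ hfull
    · exact sectorCheck_twentyone_four_s212 c (hmemR c (by simp)) ⟨hlt2, pre3⟩ hfull
    · exact sectorCheck_twentyone_four_s213 c (hmemR c (by simp)) ⟨hlt2, pre3⟩ hfull
    · exact sectorCheck_twentyone_four_s214 c (hmemR c (by simp)) ⟨hlt2, pre3⟩ hfull
    · exact sectorCheck_twentyone_four_s215 c (hmemR c (by simp)) ⟨hlt2, pre3⟩ hfull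
    · exact sectorCheck_twentyone_four_s216 c (hmemR c (by simp)) ⟨hlt2, pre3⟩ hfull
    · exact sectorCheck_twentyone_four_s217 c (hmemR c (by simp)) ⟨hlt2, pre3⟩ hfull
    · exact sectorCheck_twentyone_four_s218 c (hmemR c (by simp)) ⟨hlt2, pre3⟩ hfull
    · exact sectorCheck_twentyone_four_s219 c (hmemR c (by simp)) ⟨hlt2, pre3⟩ hfull
    · exact sectorCheck_twentyone_four_s220 c (hmemR c (by simp)) ⟨hlt2, pre3⟩ hfull
    · exact sectorCheck_twentyone_four_s221 c (hmemR c (by simp)) ⟨hlt2, pre3⟩ hfull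
    · exact sectorCheck_twentyone_four_s222 c (hmemR c (by simp)) ⟨hlt2, pre3⟩ hfull
    · exact sectorCheck_twentyone_four_s223 c (hmemR c (by simp)) ⟨hlt2, pre3⟩ hfull
    · exact sectorCheck_twentyone_four_s224 c (hmemR c (by simp)) ⟨hlt2, pre3⟩ hfull
    · exact sectorCheck_twentyone_four_s225 c (hmemR c (by simp)) ⟨hlt2, pre3⟩ hfull
    · exact sectorCheck_twentyone_four_s226 c (hmemR c (by simp)) ⟨hlt2, pre3⟩ hfull
    · exact sectorCheck_twentyone_four_s227 c (hmemR c (by simp)) ⟨hlt2, pre3⟩ hfull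
    · exact sectorCheck_twentyone_four_s228 c (hmemR c (by simp)) ⟨hlt2, pre3⟩ hfull
    · exact sectorCheck_twentyone_four_s229 c (hmemR c (by simp)) ⟨hlt2, pre3⟩ hfull
    · exact sectorCheck_twentyone_four_s230 c (hmemR c (by simp)) ⟨hlt2, pre3⟩ hfull
    · exact sectorCheck_twentyone_four_s231 c (hmemR c (by simp)) ⟨hlt2, pre3⟩ hfull
    · exact sectorCheck_twentyone_four_s232 c (hmemR c (by simp)) ⟨hlt2, pre3⟩ hfull
    · exact sectorCheck_twentyone_four_s233 c (hmemR c (by simp)) ⟨hlt2, pre3⟩ hfull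
    · exact sectorCheck_twentyone_four_s234 c (hmemR c (by simp)) ⟨hlt2, pre3⟩ hfull
    · exact sectorCheck_twentyone_four_s235 c (hmemR c (by simp)) ⟨hlt2, pre3⟩ hfull
    · exact sectorCheck_twentyone_four_s236 c (hmemR c (by simp)) ⟨hlt2, pre3⟩ hfull
    · exact sectorCheck_twentyone_four_s237 c (hmemR c (by simp)) ⟨hlt2, pre3⟩ hfull
    · exact sectorCheck_twentyone_four_s238 c (hmemR c (by simp)) ⟨hlt2, pre3⟩ hfull
    · exact sectorCheck_twentyone_four_s239 c (hmemR c (by simp)) ⟨hlt2, pre3⟩ hfull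
    · exact sectorCheck_twentyone_four_s240 c (hmemR c (by simp)) ⟨hlt2, pre3⟩ hfull
    · exact sectorCheck_twentyone_four_s241 c (hmemR c (by simp)) ⟨hlt2, pre3⟩ hfull
    · exact sectorCheck_twentyone_four_s242 c (hmemR c (by simp)) ⟨hlt2, pre3⟩ hfull
    · exact sectorCheck_twentyone_four_s243 c (hmemR c (by simp)) ⟨hlt2, pre3⟩ hfull
    · exact sectorCheck_twentyone_four_s244 c (hmemR c (by simp)) ⟨hlt2, pre3⟩ hfull
  -- the bitmask hypotheses are spent: drop them so that `omega` does not case-split on their `2^t - 1`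
  clear hfull pre3
  have hcontra : ∀ r, r ≤ 1612 → (∃ i j k l n o q i₁ j₁ k₁ l₁ n₁ o₁ q₁ i₂ j₂ k₂ l₂ n₂ o₂ q₂ : Fin 4, d i + d j + d k + d l + d n + d o + d q + d i₁ + d j₁ + d k₁ + d l₁ + d n₁ + d o₁ + d q₁ + d i₂ + d j₂ + d k₂ + d l₂ + d n₂ + d o₂ + d q₂ = r) → (List.foldr (fun (x acc : ℕ) => acc ||| (List.foldr (fun (x acc : ℕ) => acc ||| (List.foldr (fun (x acc : ℕ) => acc ||| (List.foldr (fun (x acc : ℕ) => acc ||| (List.foldr (fun (x acc : ℕ) => acc ||| (List.foldr (fun (x acc : ℕ) => acc ||| (List.foldr (fun (x acc : ℕ) => acc ||| (List.foldr (fun (x acc : ℕ) => acc ||| (List.foldr (fun (x acc : ℕ) => acc ||| (List.foldr (fun (x acc : ℕ) => acc ||| (List.foldr (fun (x acc : ℕ) => acc ||| (List.foldr (fun (x acc : ℕ) => acc ||| (List.foldr (fun (x acc : ℕ) => acc ||| (List.foldr (fun (x acc : ℕ) => acc ||| (List.foldr (fun (x acc : ℕ) => acc ||| (List.foldr (fun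 (x acc : ℕ) => acc ||| (List.foldr (fun (x acc : ℕ) => acc ||| (List.foldr (fun (x acc : ℕ) => acc ||| (List.foldr (fun (x acc : ℕ) => acc ||| (List.foldr (fun (x acc : ℕ) => acc ||| (List.foldr (fun (y acc : ℕ) => acc ||| 2 ^ y) 0 [0, a, b, c]) * 2 ^ x) 0 [0, a, b, c]) * 2 ^ x) 0 [0, a, b, c]) * 2 ^ x) 0 [0, a, b, c]) * 2 ^ x) 0 [0, a, b, c]) * 2 ^ x) 0 [0, a, b, c]) * 2 ^ x) 0 [0, a, b, c]) * 2 ^ x) 0 [0, a, b, c]) * 2 ^ x) 0 [0, a, b, c]) * 2 ^ x) 0 [0, a, b, c]) * 2 ^ x) 0 [0, a, b, c]) * 2 ^ x) 0 [0, a, b, c]) * 2 ^ x) 0 [0, a, b, c]) * 2 ^ x) 0 [0, a, b, c]) * 2 ^ x) 0 [0, a, b, c]) * 2 ^ x) 0 [0, a, b, c]) * 2 ^ x) 0 [0, a, b, c]) * 2 ^ x) 0 [0, a, b, c]) * 2 ^ x) 0 [0, a, b, c]) * 2 ^ x) 0 [0, a, b, c]) * 2 ^ x) 0 [0, a, b,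 c]).testBit r = false → False := by
    intro r hr h hf
    have hb := testBit_fold21Shift_of_mem (hmemP r hr h)
    rw [hf] at hb
    exact Bool.false_ne_true hb
  rcases Nat.lt_or_ge (pencil d S).det.natDegree 1613 with hsmall | hbig
  · interval_cases h : (pencil d S).det.natDegree
    · exact hcontra 1611 (by clear * - h; omega) htop hnoT1
    · rcases hchain 1610 (by clear * - h; omega) with h' | h'
      · rcases hnoT0T2 with hf | hf
        · exact hcontra 1610 (by clear * - h; omega) h' hf
        · exact hcontra 1612 (by clear * - h; omega) htop hf
      · exact hcontra 1611 (by clear * - h; omega) h' hnoT1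
  · rcases hchain 1610 (by clear * - hbig; omega) with h1 | h1
    · rcases hchain 1611 (by clear * - hbig; omega) with h2 | h2
      · exact hcontra 1611 (by clear * - hbig; omega) h2 hnoT1
      · rcases hnoT0T2 with hf | hf
        · exact hcontra 1610 (by clear * - hbig; omega) h1 hf
        · exact hcontra 1612 (by clear * - hbig; omega) h2 hf
    · exact hcontra 1611 (by clear * - hbig; omega) h1 hnoT1

end Summit.ValiantsHypothesis.ValiantsHypothesis.Theorems.LacunarySymmetroidMatrixDescartes.FiniteSector
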